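import Summits.CriticalPhenomena.SAWScalingLimit.Theorems.SAWTotalPositivityCriticalBubbleBoundKestenHWCut
import HarnessLib

/-!
# Line `kesten-product-renewal-dictionary` for the crux `SAWTotalPositivity.CriticalBubbleBound`
(stmt-CriticalPhenomena-7117): symmetry and non-degeneracy of the transversal step of Kesten's
renewal walk (stub `ms_irrBridge_reflect`)

In the step-word model of self-avoiding walks on `ℤ²` (`SAWWords.lean`, `SAWWordBridges.lean`:
`Step = Fin 4`, `0 ↦ +e₀` (E), `1 ↦ +e₁` (N), `2 ↦ -e₀` (W), `3 ↦ -e₁` (S); `wEnd w` the endpoint,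
`traj w i` the position after `i` steps, `xAt w i = traj w i 0`, `IsIrrBridge w` an irreducible
self-avoiding bridge word) we prove:

* the letter swap `N ↔ S` (`1 ↔ 3`, reflection in the horizontal axis `x₁ = 0`) is an involution
  of step words preserving length, the first coordinate of every position (hence bridges, break
  points and irreducibility), self-avoidance, and negating the second coordinate of the endpoint;
  in particular it maps irreducible bridges to irreducible bridges of the same length and span and
  of opposite transversal displacement (the symmetry of the transversal step of Kesten's renewal
  walk of i.i.d. irreducible bridges);
* the two-letter word `E, N = [0, 1]` is an irreducible bridge with transversal displacement `1`
  (non-degeneracy of that step).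

Source: N. Madras, G. Slade, *The Self-Avoiding Walk*, Birkhäuser (1993), §8.1 (Kesten's
irreducible bridges and the renewal structure, Lemma 8.1.8); H. Kesten, *On the number of
self-avoiding walks*, J. Math. Phys. 4 (1963), §4.
-/

noncomputable section

open Literature.Probability.LatticeModels
open Literature.Probability.RandomPlanarGeometry Literature.Probability.RandomPlanarGeometry.SAW
open scoped BigOperators
open Classical

namespace Summit.CriticalPhenomena.SAWScalingLimit.Theorems.CriticalBubbleBound.Kesten.MS

/-! ## Reflecting a word in the horizontal axis -/

/-- If a letter map `r` preserves `dx` and negates `dy` (e.g. the swap `1 ↔ 3`), the endpoint of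
`w.map r` is the reflection of the endpoint of `w` in the axis `x₁ = 0`: same first coordinate,
opposite second coordinate. [folklore] -/
theorem wEnd_map_of_dy (r : Step → Step) (hx : ∀ d, Step.dx (r d) = Step.dx d)
    (hy : ∀ d, Step.dy (r d) = -Step.dy d) (w : List Step) :
    wEnd (w.map r) 0 = wEnd w 0 ∧ wEnd (w.map r) 1 = -wEnd w 1 := by
  induction w with
  | nil => simp
  | cons d w ih =>
    obtain ⟨ih0, ih1⟩ := ih
    rw [List.map_cons, wEnd_cons, wEnd_cons]
    refine ⟨?_, ?_⟩
    · simp only [Fin.isValue, Pi.add_apply, Step.vec_apply_zero, hx, ih0]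
    · simp only [Fin.isValue, Pi.add_apply, Step.vec_apply_one, hy, ih1]
      ring

/-- The trajectory of the reflected word is the pointwise reflection of the trajectory in the
axis `x₁ = 0`. [folklore] -/
theorem traj_map_of_dy (r : Step → Step) (hx : ∀ d, Step.dx (r d) = Step.dx d)
    (hy : ∀ d, Step.dy (r d) = -Step.dy d) (w : List Step) (i : ℕ) :
    traj (w.map r) i 0 = traj w i 0 ∧ traj (w.map r) i 1 = -traj w i 1 := by
  rw [traj, traj, ← List.map_take]
  exact wEnd_map_of_dy r hx hy _

/-- The first coordinates of the reflected word are those of the original one. [folklore] -/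
theorem xAt_map_of_dy (r : Step → Step) (hx : ∀ d, Step.dx (r d) = Step.dx d)
    (hy : ∀ d, Step.dy (r d) = -Step.dy d) (w : List Step) (i : ℕ) :
    xAt (w.map r) i = xAt w i :=
  (traj_map_of_dy r hx hy w i).1

/-- The span of the reflected word is that of the original one. [folklore] -/
theorem xEnd_map_of_dy (r : Step → Step) (hx : ∀ d, Step.dx (r d) = Step.dx d)
    (hy : ∀ d, Step.dy (r d) = -Step.dy d) (w : List Step) : xEnd (w.map r) = xEnd w := by
  rw [xEnd, xEnd, List.length_map, xAt_map_of_dy r hx hy]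

/-- Reflection in the horizontal axis preserves bridges. [folklore] -/
theorem isBridgeW_map_of_dy (r : Step → Step) (hx : ∀ d, Step.dx (r d) = Step.dx d)
    (hy : ∀ d, Step.dy (r d) = -Step.dy d) {w : List Step} (hb : IsBridgeW w) :
    IsBridgeW (w.map r) := by
  rw [isBridgeW_iff] at hb ⊢
  intro i h1 h2
  rw [List.length_map] at h2
  rw [xAt_map_of_dy r hx hy, xEnd_map_of_dy r hx hy]
  exact hb i h1 h2

/-- Reflection in the horizontal axis does not change the break points. [folklore] -/
theorem isBreak_map_of_dy_iff (r : Step → Step) (hx : ∀ d, Step.dx (r d) = Step.dx d)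
    (hy : ∀ d, Step.dy (r d) = -Step.dy d) (w : List Step) (j : ℕ) :
    IsBreak (w.map r) j ↔ IsBreak w j := by
  simp only [IsBreak, List.length_map, xAt_map_of_dy r hx hy]

/-- Reflection in the horizontal axis preserves irreducibility. [folklore] -/
theorem isIrreducible_map_of_dy (r : Step → Step) (hx : ∀ d, Step.dx (r d) = Step.dx d)
    (hy : ∀ d, Step.dy (r d) = -Step.dy d) {w : List Step} (h : IsIrreducible w) :
    IsIrreducible (w.map r) :=
  fun j hj => h j ((isBreak_map_of_dy_iff r hx hy w j).1 hj)

/-- Reflection in the horizontal axis preserves self-avoidance. [folklore] -/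
theorem isSAW_map_of_dy (r : Step → Step) (hx : ∀ d, Step.dx (r d) = Step.dx d)
    (hy : ∀ d, Step.dy (r d) = -Step.dy d) {w : List Step} (hs : IsSAW w) : IsSAW (w.map r) := by
  rw [isSAW_iff_injOn] at hs ⊢
  rw [List.length_map]
  intro i hi j hj hij
  refine hs hi hj ?_
  funext k
  fin_cases k
  · have h0 := congrFun hij 0
    rwa [(traj_map_of_dy r hx hy w i).1, (traj_map_of_dy r hx hy w j).1] at h0
  · have h1 := congrFun hij 1
    rw [(traj_map_of_dy r hx hy w i).2, (traj_map_of_dy r hx hy w j).2] at h1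
    exact neg_injective h1

/-- Reflection in the horizontal axis maps irreducible bridges to irreducible bridges.
[folklore] -/
theorem isIrrBridge_map_of_dy (r : Step → Step) (hx : ∀ d, Step.dx (r d) = Step.dx d)
    (hy : ∀ d, Step.dy (r d) = -Step.dy d) {w : List Step} (h : IsIrrBridge w) :
    IsIrrBridge (w.map r) :=
  ⟨isSAW_map_of_dy r hx hy h.saw, isBridgeW_map_of_dy r hx hy h.bridge,
    isIrreducible_map_of_dy r hx hy h.irr, fun h0 => h.ne_nil (List.map_eq_nil_iff.1 h0)⟩

/-! ## The word `E, N` -/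

/-- First coordinates along the word `E, N`: `x(1) = 1`. [folklore] -/
theorem xAt_EN_one : xAt [0, 1] 1 = 1 := by decide

/-- First coordinates along the word `E, N`: `x(2) = 1`. [folklore] -/
theorem xAt_EN_two : xAt [0, 1] 2 = 1 := by decide

/-- The word `E, N` is an irreducible bridge (its only candidate break point `j = 1` fails
`x(1) < x(2)`). [cite: MadrasSlade1993, Lemma 8.1.8] -/
theorem isIrrBridge_EN : IsIrrBridge [0, 1] := by
  refine ⟨by decide, ?_, ?_, List.cons_ne_nil _ _⟩
  · rw [isBridgeW_iff]
    intro i h1 h2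
    have hlen : ([0, 1] : List Step).length = 2 := rfl
    rw [hlen] at h2
    have hend : xEnd ([0, 1] : List Step) = 1 := xAt_EN_two
    rw [hend]
    rcases (show i = 1 ∨ i = 2 by omega) with rfl | rfl
    · rw [xAt_EN_one]; exact ⟨one_pos, le_rfl⟩
    · rw [xAt_EN_two]; exact ⟨one_pos, le_rfl⟩
  · rintro j ⟨h0, hj, -, hgt⟩
    have hlen : ([0, 1] : List Step).length = 2 := rfl
    rw [hlen] at hj hgt
    obtain rfl : j = 1 := by omega
    have := hgt 2 (by norm_num) le_rfl
    rw [xAt_EN_one, xAt_EN_two] at this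
    exact lt_irrefl _ this

/-! ## The stub -/

/-- **Symmetry and non-degeneracy of the transversal step of Kesten's renewal walk.** The letter
swap `N ↔ S` (`1 ↔ 3`) is an involution `r` of step words mapping irreducible bridges to
irreducible bridges, preserving the length and the first coordinate of the endpoint (the span)
and negating its second coordinate (the transversal displacement); and the word `E, N = [0, 1]`
is an irreducible bridge of transversal displacement `1`.
[cite: MadrasSlade1993, Lemma 8.1.8] -/
theorem ms_irrBridge_reflect : (∃ r : List Step → List Step, Function.Involutive r ∧ ∀ w : List Step, (IsIrrBridge w → IsIrrBridge (r w)) ∧ (r w).length = w.length ∧ wEnd (r w) 1 = -wEnd w 1 ∧ wEnd (r w) 0 = wEnd w 0) ∧ (IsIrrBridge [0, 1] ∧ wEnd [0, 1] 1 = 1) := by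
  -- the letter swap `1 ↔ 3` (reflection in the horizontal axis) and its properties
  have hx : ∀ d : Step,
      Step.dx ((fun d : Step => if d = 1 then (3 : Step) else if d = 3 then 1 else d) d) = Step.dx d := by
    decide
  have hy : ∀ d : Step,
      Step.dy ((fun d : Step => if d = 1 then (3 : Step) else if d = 3 then 1 else d) d) = -Step.dy d := by
    decide
  have hinv : ∀ d : Step, (fun d : Step => if d = 1 then (3 : Step) else if d = 3 then 1 else d)
      ((fun d : Step => if d = 1 then (3 : Step) else if d = 3 then 1 else d) d) = d := by
    decide
  refine ⟨⟨List.map (fun d : Step => if d = 1 then (3 : Step) else if d = 3 then 1 else d),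
    List.map_involutive_iff.2 hinv, fun w => ⟨isIrrBridge_map_of_dy _ hx hy, List.length_map _,
      (wEnd_map_of_dy _ hx hy w).2, (wEnd_map_of_dy _ hx hy w).1⟩⟩, isIrrBridge_EN, by decide⟩

end Summit.CriticalPhenomena.SAWScalingLimit.Theorems.CriticalBubbleBound.Kesten.MS

end
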